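import Summits.CriticalPhenomena.SAWScalingLimit.Theorems.SAWTotalPositivityBoundaryTP2Strip4Tail
import Summits.CriticalPhenomena.SAWScalingLimit.Theorems.SAWTotalPositivityBoundaryTP2Strip4SectorTraj
import Summits.CriticalPhenomena.SAWScalingLimit.Theorems.SAWTotalPositivityBoundaryTP2Strip4Corner
import Summits.CriticalPhenomena.SAWScalingLimit.Theorems.SAWTotalPositivityBoundaryTP2Strip4Table
import HarnessLib

/-!
# Crux `BoundaryTP2` (stmt-CriticalPhenomena-7115), line `Sketch`: **the crux `BoundaryTP2` AS TYPED on EVERY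
two-left/two-right quadruple of EVERY 4-row strip** — the kernel matrix `K_n(r,s) = Z((0,r),(n,s))` of
`S_n = {0..n} × {0..3}` is TP₂ for every length `n` and every `x ∈ [1/3, 5/13]` (lead c6, `StripCert` part 8)

Assembly: the strip kernels instantiate the data-driven sector trajectories (…Strip4SectorTraj); the reflection
symmetries give the kernel table `K = [[a,b,c,d],[b,e,f,c],[c,f,e,b],[d,c,b,a]]` and the identification
`W± n 0 = U± n 1`; `strip4_mixedForms` (part 7: certified tail boxes/rates for `n ≥ 7`, direct kernel checks
for `n ≤ 6`) gives the six mixed forms, `strip4_odd_signs` (…Strip4Corner) the signs `d ≤ a, c ≤ b, f ≤ e`;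
together the thirteen forms, i.e. all 36 minors (`strip4_tp2`).  The typed statement `boundaryTP2_strip4`
(interlacing and the two disjoint realisations from `stub_rect_facingPairs`, conclusion at `x_c` given
`x_c ≤ 5/13`) covers both labellings of every quadruple with two marked points on each vertical side. [folklore]
-/

noncomputable section

namespace Summit.CriticalPhenomena.SAWScalingLimit.Theorems.BoundaryTP2

open Literature.Probability.LatticeModels Literature.Probability.RandomPlanarGeometry
open Summit.CriticalPhenomena.SAWScalingLimit.Theorems.EdgeOfPositivity.Negative
open Summit.CriticalPhenomena.SAWScalingLimit.Theorems.BoundaryTP2.Negative.Cert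
open Summit.CriticalPhenomena.SAWScalingLimit.Theorems.BoundaryTP2.StripCert
open scoped ENNReal

/-! ## §18 The thirteen forms in the letters -/

/-- **The thirteen TP₂ forms of the 4-row strips in the six real letters** `a,b,c,d = Z((0,0),(n,0..3))`,
`e,f = Z((0,1),(n,1..2))` (real parts): `b² ≤ ae, bc ≤ af, bd ≤ ac, ce ≤ bf, de ≤ bc, df ≤ c², c² ≤ ae, cd ≤ ab,
cf ≤ be, df ≤ b², d² ≤ a², c² ≤ b², f² ≤ e²`, every `n`, every `x ∈ [1/3, 5/13]`. [folklore] -/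
theorem strip4_forms_real (n : ℕ) {x : ℝ} (hx1 : 1 / 3 ≤ x) (hx2 : x ≤ 5 / 13) :
    (pathKernel (discreteDomainGraph (rectDomain n 3) 1) x (st 0 0) (st n 1)).toReal *
        (pathKernel (discreteDomainGraph (rectDomain n 3) 1) x (st 0 0) (st n 1)).toReal ≤
      (pathKernel (discreteDomainGraph (rectDomain n 3) 1) x (st 0 0) (st n 0)).toReal *
        (pathKernel (discreteDomainGraph (rectDomain n 3) 1) x (st 0 1) (st n 1)).toReal ∧
    (pathKernel (discreteDomainGraph (rectDomain n 3) 1) x (st 0 0) (st n 1)).toReal *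
        (pathKernel (discreteDomainGraph (rectDomain n 3) 1) x (st 0 0) (st n 2)).toReal ≤
      (pathKernel (discreteDomainGraph (rectDomain n 3) 1) x (st 0 0) (st n 0)).toReal *
        (pathKernel (discreteDomainGraph (rectDomain n 3) 1) x (st 0 1) (st n 2)).toReal ∧
    (pathKernel (discreteDomainGraph (rectDomain n 3) 1) x (st 0 0) (st n 1)).toReal *
        (pathKernel (discreteDomainGraph (rectDomain n 3) 1) x (st 0 0) (st n 3)).toReal ≤
      (pathKernel (discreteDomainGraph (rectDomain n 3) 1) x (st 0 0) (st n 0)).toReal *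
        (pathKernel (discreteDomainGraph (rectDomain n 3) 1) x (st 0 0) (st n 2)).toReal ∧
    (pathKernel (discreteDomainGraph (rectDomain n 3) 1) x (st 0 0) (st n 2)).toReal *
        (pathKernel (discreteDomainGraph (rectDomain n 3) 1) x (st 0 1) (st n 1)).toReal ≤
      (pathKernel (discreteDomainGraph (rectDomain n 3) 1) x (st 0 0) (st n 1)).toReal *
        (pathKernel (discreteDomainGraph (rectDomain n 3) 1) x (st 0 1) (st n 2)).toReal ∧
    (pathKernel (discreteDomainGraph (rectDomain n 3) 1) x (st 0 0) (st n 3)).toReal *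
        (pathKernel (discreteDomainGraph (rectDomain n 3) 1) x (st 0 1) (st n 1)).toReal ≤
      (pathKernel (discreteDomainGraph (rectDomain n 3) 1) x (st 0 0) (st n 1)).toReal *
        (pathKernel (discreteDomainGraph (rectDomain n 3) 1) x (st 0 0) (st n 2)).toReal ∧
    (pathKernel (discreteDomainGraph (rectDomain n 3) 1) x (st 0 0) (st n 3)).toReal *
        (pathKernel (discreteDomainGraph (rectDomain n 3) 1) x (st 0 1) (st n 2)).toReal ≤
      (pathKernel (discreteDomainGraph (rectDomain n 3) 1) x (st 0 0) (st n 2)).toReal *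
        (pathKernel (discreteDomainGraph (rectDomain n 3) 1) x (st 0 0) (st n 2)).toReal ∧
    (pathKernel (discreteDomainGraph (rectDomain n 3) 1) x (st 0 0) (st n 2)).toReal *
        (pathKernel (discreteDomainGraph (rectDomain n 3) 1) x (st 0 0) (st n 2)).toReal ≤
      (pathKernel (discreteDomainGraph (rectDomain n 3) 1) x (st 0 0) (st n 0)).toReal *
        (pathKernel (discreteDomainGraph (rectDomain n 3) 1) x (st 0 1) (st n 1)).toReal ∧
    (pathKernel (discreteDomainGraph (rectDomain n 3) 1) x (st 0 0) (st n 2)).toReal *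
        (pathKernel (discreteDomainGraph (rectDomain n 3) 1) x (st 0 0) (st n 3)).toReal ≤
      (pathKernel (discreteDomainGraph (rectDomain n 3) 1) x (st 0 0) (st n 0)).toReal *
        (pathKernel (discreteDomainGraph (rectDomain n 3) 1) x (st 0 0) (st n 1)).toReal ∧
    (pathKernel (discreteDomainGraph (rectDomain n 3) 1) x (st 0 0) (st n 2)).toReal *
        (pathKernel (discreteDomainGraph (rectDomain n 3) 1) x (st 0 1) (st n 2)).toReal ≤
      (pathKernel (discreteDomainGraph (rectDomain n 3) 1) x (st 0 0) (st n 1)).toReal *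
        (pathKernel (discreteDomainGraph (rectDomain n 3) 1) x (st 0 1) (st n 1)).toReal ∧
    (pathKernel (discreteDomainGraph (rectDomain n 3) 1) x (st 0 0) (st n 3)).toReal *
        (pathKernel (discreteDomainGraph (rectDomain n 3) 1) x (st 0 1) (st n 2)).toReal ≤
      (pathKernel (discreteDomainGraph (rectDomain n 3) 1) x (st 0 0) (st n 1)).toReal *
        (pathKernel (discreteDomainGraph (rectDomain n 3) 1) x (st 0 0) (st n 1)).toReal ∧
    (pathKernel (discreteDomainGraph (rectDomain n 3) 1) x (st 0 0) (st n 3)).toReal *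
        (pathKernel (discreteDomainGraph (rectDomain n 3) 1) x (st 0 0) (st n 3)).toReal ≤
      (pathKernel (discreteDomainGraph (rectDomain n 3) 1) x (st 0 0) (st n 0)).toReal *
        (pathKernel (discreteDomainGraph (rectDomain n 3) 1) x (st 0 0) (st n 0)).toReal ∧
    (pathKernel (discreteDomainGraph (rectDomain n 3) 1) x (st 0 0) (st n 2)).toReal *
        (pathKernel (discreteDomainGraph (rectDomain n 3) 1) x (st 0 0) (st n 2)).toReal ≤
      (pathKernel (discreteDomainGraph (rectDomain n 3) 1) x (st 0 0) (st n 1)).toReal *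
        (pathKernel (discreteDomainGraph (rectDomain n 3) 1) x (st 0 0) (st n 1)).toReal ∧
    (pathKernel (discreteDomainGraph (rectDomain n 3) 1) x (st 0 1) (st n 2)).toReal *
        (pathKernel (discreteDomainGraph (rectDomain n 3) 1) x (st 0 1) (st n 2)).toReal ≤
      (pathKernel (discreteDomainGraph (rectDomain n 3) 1) x (st 0 1) (st n 1)).toReal *
        (pathKernel (discreteDomainGraph (rectDomain n 3) 1) x (st 0 1) (st n 1)).toReal := by
  have hx0 : 0 ≤ x := by linarith
  obtain ⟨t10, t20, t30, t13, t21, t22, t23, t31, t32, t33⟩ := strip4_table n x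
  -- the four data-driven trajectories
  obtain ⟨Up, hUp0, hUp, hUpd⟩ := strip4_evenTraj hx0 0 3 (Or.inl ⟨rfl, rfl⟩)
  obtain ⟨Wp, hWp0, hWp, hWpd⟩ := strip4_evenTraj hx0 1 2 (Or.inr ⟨rfl, rfl⟩)
  obtain ⟨Uo, hUo0, hUo, hUod⟩ := strip4_oddTraj hx0 0 3 (Or.inl ⟨rfl, rfl⟩)
  obtain ⟨Wo, hWo0, hWo, hWod⟩ := strip4_oddTraj hx0 1 2 (Or.inr ⟨rfl, rfl⟩)
  simp only [if_pos] at hUp0 hUo0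
  rw [if_neg (by norm_num)] at hWp0 hWo0
  have hsymP : ∀ m, Wp m 0 = Up m 1 := by
    intro m
    obtain ⟨t10', t20', -, -, -, -, -, t31', -, -⟩ := strip4_table m x
    rw [(hWpd m).1, (hUpd m).2, t10', t20', t31']
  have hsymM : ∀ m, Wo m 0 = Uo m 1 := by
    intro m
    obtain ⟨t10', t20', -, -, -, -, -, t31', -, -⟩ := strip4_table m x
    rw [(hWod m).1, (hUod m).2, t10', t20', t31']
  obtain ⟨F1, F2, F3, F4, F5, F6⟩ :=
    strip4_mixedForms hx1 hx2 Up Wp Uo Wo hUp0 hUp hWp0 hWp hUo0 hUo hWo0 hWo hsymP hsymM n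
  simp only [(hUpd n).1, (hUpd n).2, (hWpd n).2, (hUod n).1, (hUod n).2, (hWod n).2, t30, t31, t21]
    at F1 F2 F3 F4 F5 F6
  -- signs
  obtain ⟨sda, scb, -, sfe⟩ := strip4_odd_signs n hx1 hx2
  have fin := strip4_ne_top n x
  have hda := (ENNReal.toReal_le_toReal (fin _ _) (fin _ _)).2 sda
  have hcb := (ENNReal.toReal_le_toReal (fin _ _) (fin _ _)).2 scb
  have hfe := (ENNReal.toReal_le_toReal (fin _ _) (fin _ _)).2 sfe
  have ha : 0 ≤ (pathKernel (discreteDomainGraph (rectDomain n 3) 1) x (st 0 0) (st n 0)).toReal := ENNReal.toReal_nonneg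
  have hb : 0 ≤ (pathKernel (discreteDomainGraph (rectDomain n 3) 1) x (st 0 0) (st n 1)).toReal := ENNReal.toReal_nonneg
  have hc : 0 ≤ (pathKernel (discreteDomainGraph (rectDomain n 3) 1) x (st 0 0) (st n 2)).toReal := ENNReal.toReal_nonneg
  have hd : 0 ≤ (pathKernel (discreteDomainGraph (rectDomain n 3) 1) x (st 0 0) (st n 3)).toReal := ENNReal.toReal_nonneg
  have he : 0 ≤ (pathKernel (discreteDomainGraph (rectDomain n 3) 1) x (st 0 1) (st n 1)).toReal := ENNReal.toReal_nonneg
  have hf : 0 ≤ (pathKernel (discreteDomainGraph (rectDomain n 3) 1) x (st 0 1) (st n 2)).toReal := ENNReal.toReal_nonneg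
  clear hsymP hsymM hUpd hWpd hUod hWod hUp hWp hUo hWo hUp0 hWp0 hUo0 hWo0 t10 t20 t30 t13 t21 t22 t23 t31 t32 t33 sda scb sfe
  generalize (pathKernel (discreteDomainGraph (rectDomain n 3) 1) x (st 0 0) (st n 0)).toReal = a at *
  generalize (pathKernel (discreteDomainGraph (rectDomain n 3) 1) x (st 0 0) (st n 1)).toReal = b at *
  generalize (pathKernel (discreteDomainGraph (rectDomain n 3) 1) x (st 0 0) (st n 2)).toReal = c at *
  generalize (pathKernel (discreteDomainGraph (rectDomain n 3) 1) x (st 0 0) (st n 3)).toReal = d at *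
  generalize (pathKernel (discreteDomainGraph (rectDomain n 3) 1) x (st 0 1) (st n 1)).toReal = e at *
  generalize (pathKernel (discreteDomainGraph (rectDomain n 3) 1) x (st 0 1) (st n 2)).toReal = f at *
  -- the six mixed forms
  have m1 : b * b ≤ a * e := by nlinarith [F1]
  have m2 : b * c ≤ a * f := by nlinarith [F2]
  have m3 : b * d ≤ a * c := by nlinarith [F3]
  have m4 : c * e ≤ b * f := by nlinarith [F4]
  have m5 : d * e ≤ b * c := by nlinarith [F5]
  have m6 : d * f ≤ c * c := by nlinarith [F6]
  refine ⟨m1, m2, m3, m4, m5, m6, ?_, ?_, ?_, ?_, ?_, ?_, ?_⟩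
  · nlinarith [mul_nonneg (sub_nonneg.2 hcb) (add_nonneg hb hc)]
  · nlinarith [mul_le_mul hda hcb hc ha, mul_nonneg hd hc]
  · nlinarith [mul_le_mul hcb hfe hf hb]
  · nlinarith [mul_nonneg (sub_nonneg.2 hcb) (add_nonneg hb hc)]
  · nlinarith [mul_le_mul hda hda hd ha]
  · nlinarith [mul_le_mul hcb hcb hc hb]
  · nlinarith [mul_le_mul hfe hfe hf he]

/-! ## §19 TP₂ of the kernel matrix, and the crux as typed -/

set_option maxHeartbeats 800000 in
set_option linter.unusedSimpArgs false in
/-- **TP₂ of the kernel matrix of every 4-row strip**: for `0 ≤ r < r' ≤ 3`, `0 ≤ s < s' ≤ 3`, every length `n`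
and every `x ∈ [1/3, 5/13]`, `Z((0,r),(n,s')) · Z((0,r'),(n,s)) ≤ Z((0,r),(n,s)) · Z((0,r'),(n,s'))`. [folklore] -/
theorem strip4_tp2 (n : ℕ) {x : ℝ} (hx1 : 1 / 3 ≤ x) (hx2 : x ≤ 5 / 13) {r r' s s' : ℤ} (hr0 : 0 ≤ r)
    (hrr : r < r') (hr3 : r' ≤ 3) (hs0 : 0 ≤ s) (hss : s < s') (hs3 : s' ≤ 3) :
    pathKernel (discreteDomainGraph (rectDomain n 3) 1) x (st 0 r) (st n s') *
        pathKernel (discreteDomainGraph (rectDomain n 3) 1) x (st 0 r') (st n s) ≤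
      pathKernel (discreteDomainGraph (rectDomain n 3) 1) x (st 0 r) (st n s) *
        pathKernel (discreteDomainGraph (rectDomain n 3) 1) x (st 0 r') (st n s') := by
  obtain ⟨f1, f2, f3, f4, f5, f6, f7, f8, f9, f10, f11, f12, f13⟩ := strip4_forms_real n hx1 hx2
  obtain ⟨t10, t20, t30, t13, t21, t22, t23, t31, t32, t33⟩ := strip4_table n x
  have fin := strip4_ne_top n x
  have hr2 : r ≤ 2 := by omega
  have hr1 : 1 ≤ r' := by omega
  have hs2 : s ≤ 2 := by omega
  have hs1 : 1 ≤ s' := by omega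
  interval_cases r <;> interval_cases r' <;> interval_cases s <;> interval_cases s'
  all_goals try simp only [t10, t20, t30, t13, t21, t22, t23, t31, t32, t33]
  all_goals refine s4tp_mul_le (fin _ _) (fin _ _) (fin _ _) (fin _ _) ?_
  all_goals linarith

/-- **The crux `BoundaryTP2` AS TYPED on every 4-row strip, every quadruple with two marked boundary points on each
vertical side** (`p₁ = (0,j₁)`, `p₄ = (0,j₂)` left, `p₂ = (n,j₄)`, `p₃ = (n,j₃)` right, `j₂ < j₁`, `j₃ < j₄`,
`n ≥ 1`): the three hypotheses hold as typed and the conclusion `Z(p₁,p₃)Z(p₂,p₄) ≤ Z(p₁,p₂)Z(p₃,p₄)` holds at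
`x_c`, given `x_c ≤ 5/13`. [folklore] -/
theorem boundaryTP2_strip4 (hxc : SAW.criticalFugacity ≤ 5 / 13) (n : ℕ) (hn : 1 ≤ n) {j₁ j₂ j₃ j₄ : ℤ}
    (h₂ : 0 ≤ j₂) (h₂₁ : j₂ < j₁) (h₁ : j₁ ≤ 3) (h₃ : 0 ≤ j₃) (h₃₄ : j₃ < j₄) (h₄ : j₄ ≤ 3) :
    (∀ (P : SAW.DomainSAW (rectDomain n 3) 1 (st 0 j₁) (st n j₃))
        (Q : SAW.DomainSAW (rectDomain n 3) 1 (st n j₄) (st 0 j₂)),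
        ∃ v, v ∈ P.walk.support ∧ v ∈ Q.walk.support) ∧
    (∃ (P : SAW.DomainSAW (rectDomain n 3) 1 (st 0 j₁) (st n j₄))
        (Q : SAW.DomainSAW (rectDomain n 3) 1 (st n j₃) (st 0 j₂)),
        List.Disjoint P.walk.support Q.walk.support) ∧
    (∃ (P : SAW.DomainSAW (rectDomain n 3) 1 (st 0 j₁) (st 0 j₂))
        (Q : SAW.DomainSAW (rectDomain n 3) 1 (st n j₄) (st n j₃)),
        List.Disjoint P.walk.support Q.walk.support) ∧
    SAW.weight (rectDomain n 3) 1 (st 0 j₁) (st n j₃) Set.univ *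
        SAW.weight (rectDomain n 3) 1 (st n j₄) (st 0 j₂) Set.univ ≤
      SAW.weight (rectDomain n 3) 1 (st 0 j₁) (st n j₄) Set.univ *
        SAW.weight (rectDomain n 3) 1 (st n j₃) (st 0 j₂) Set.univ := by
  obtain ⟨hI, hD₁, hD₂⟩ := stub_rect_facingPairs n 3 hn h₂ h₂₁ h₁ h₃ h₃₄ h₄
  have hI' := hI.reverse_right
  have hD₁' := hD₂.reverse_right
  have hD₂' := hD₁.reverse_right
  refine ⟨fun P Q => hI' ⟨P.walk, P.isPath⟩ ⟨Q.walk, Q.isPath⟩, ?_, ?_, ?_⟩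
  · obtain ⟨P, Q, hPQ⟩ := hD₁'
    exact ⟨⟨P.1, P.2⟩, ⟨Q.1, Q.2⟩, by simpa using hPQ⟩
  · obtain ⟨P, Q, hPQ⟩ := hD₂'
    exact ⟨⟨P.1, P.2⟩, ⟨Q.1, Q.2⟩, by simpa using hPQ⟩
  · simp only [weight_univ_eq_pathKernel]
    rw [pathKernel_comm _ _ (st n j₄) (st 0 j₂), pathKernel_comm _ _ (st n j₃) (st 0 j₂)]
    -- Z(j₁,j₃) Z(j₂,j₄) ≤ Z(j₁,j₄) Z(j₂,j₃)  with rows j₂ < j₁ and columns j₃ < j₄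
    have h := strip4_tp2 n SAW.one_third_le_criticalFugacity hxc h₂ h₂₁ h₁ h₃ h₃₄ h₄
    -- h : Z(j₂,j₄) Z(j₁,j₃) ≤ Z(j₂,j₃) Z(j₁,j₄)
    calc _ = pathKernel _ SAW.criticalFugacity (st 0 j₂) (st n j₄) *
          pathKernel _ SAW.criticalFugacity (st 0 j₁) (st n j₃) := mul_comm _ _
      _ ≤ _ := h
      _ = _ := mul_comm _ _

end Summit.CriticalPhenomena.SAWScalingLimit.Theorems.BoundaryTP2
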